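import Literature.NumberTheory.ModularForms.Lemma49Tools
import Literature.NumberTheory.ModularForms.InterpolationKernels
import HarnessLib

/-!
# CKMRV Lemma 4.9, inequalities (4.15) and (4.17), for `𝒦₊^{(8)}` with `γ = I`

Cohn–Kumar–Miller–Radchenko–Viazovska, arXiv:1902.05438, Lemma 4.9: with `n_{+,τ} = 0`,
`n_{+,z} = 2`, `n̂_τ^{(8)} = 2`, for each `δ > 0` there is `C` such that for `Im τ, Im z ≥ δ` with
`j(τ) ≠ j(z)`,
(4.15) `|(𝒦₊^{(8)}|^z_{−2} S)(τ,z)| ≤ C |e^{πi(0·τ + 2z)} τ²z² / (Δ(τ)Δ(z)(j(τ)−j(z)))|`,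
(4.17) `|(𝒦₊^{(8)}|^z_{−2} S)(τ,z)| ≤ C |e^{πi(2τ + z)} τ²z² / (Δ(τ)Δ(z)(j(τ)−j(z)))|`.

PROVED here in multiplied-out form (no division; at the poles the left side is `0`): with
`L(τ,z) = 𝒦₊^{(8)}(τ, Sz)·z²·Δ(τ)Δ(z)(j(τ)−j(z))` (`(g|_{−2}S)(z) = g(Sz)z²`),
`‖L(τ,z)‖ ≤ C|τ|²|z|² e^{−2π Im z}` (`kernelPlus8_S_bound_415`) and
`‖L(τ,z)‖ ≤ C|τ|²|z|² e^{−2π Im τ} e^{−π Im z}` (`kernelPlus8_S_bound_417`).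
Mechanism (the paper's "direct calculation"): off the poles
`L = c[φ₋₂E₆(τ)(R + Δ(τ)E₈E₂²(z)) − 2φ₀E₄(τ)(R + Δ(τ)E₁₀E₂(z)) + φ₂E₁₄(τ)Δ(z)]`,
`R = E₄(τ)³Δ(z) − E₄(z)³Δ(τ)` (using `E_k(Sz) = z^kE_k(z)`, `Δ(Sz) = z¹²Δ(z)`, `φ̃₋₂(Sz) = z⁻²`,
`φ̃₀(Sz) = E₂(z)`, `φ̃₂(Sz) = z²E₂(z)²`), a sum of products `Σ fᵢ(τ)hᵢ(z)` whose constant terms in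
`q_z` cancel (`Σ fᵢ·[hᵢ]₀ = 0`) and whose constant terms in `q_τ` cancel (`Σ [fᵢ]₀·hᵢ = 0`,
`[φ₋₂]₀ = τ`, `[φ₀]₀ = τ − 3i/π`, `[φ₂]₀ = τ − 6i/π`); the uniform remainder bounds on `Im ≥ δ`
come from `Lemma49Tools` / `UniformBounds`.

## References

* H. Cohn, A. Kumar, S. D. Miller, D. Radchenko, M. Viazovska, Ann. of Math. 196 (2022),
  arXiv:1902.05438, Lemma 4.9 (4.15), (4.17). [CohnEtAl2019]
-/

noncomputable section

open Complex hiding I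
open Filter Topology Asymptotics ModularForm SlashInvariantForm EisensteinSeries
open UpperHalfPlane hiding I
open Complex (I)
open scoped Real MatrixGroups ModularForm Manifold

namespace Literature.NumberTheory.ModularForms

open Literature.NumberTheory.EllipticCurves.ModularForms (kleinJ kleinJ_smul E₄_cube_eq_kleinJ_mul)

/-! ## `S`-transformation of the building blocks -/

/-- `E₄(Sz) = z⁴E₄(z)`, `E₆(Sz) = z⁶E₆(z)`, `Δ(Sz) = z¹²Δ(z)`. [folklore] -/
theorem levelOne_S_smul {k : ℤ} (f : ModularForm 𝒮ℒ k) (z : ℍ) : f (ModularGroup.S • z) = (z : ℂ) ^ k * f z := by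
  have hS : (⇑f : ℍ → ℂ) ∣[k] ModularGroup.S = ⇑f := f.slash_action_eq' _ ⟨ModularGroup.S, rfl⟩
  have h := slash_S_apply' (⇑f) k z
  rw [hS] at h
  have hz : (z : ℂ) ≠ 0 := z.ne_zero
  rw [h, mul_comm, mul_assoc, ← zpow_add₀ hz, neg_add_cancel, zpow_zero, mul_one]

/-- `E₄(Sz) = z⁴E₄(z)`. [folklore] -/
theorem E₄_S_smul (z : ℍ) : E₄ (ModularGroup.S • z) = (z : ℂ) ^ 4 * E₄ z := by
  have := levelOne_S_smul E₄ z
  rwa [zpow_ofNat] at this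

/-- `E₆(Sz) = z⁶E₆(z)`. [folklore] -/
theorem E₆_S_smul (z : ℍ) : E₆ (ModularGroup.S • z) = (z : ℂ) ^ 6 * E₆ z := by
  have := levelOne_S_smul E₆ z
  rwa [zpow_ofNat] at this

/-- `Δ(Sz) = z¹²Δ(z)`. [folklore] -/
theorem discriminant_S_smul' (z : ℍ) : ModularForm.discriminant (ModularGroup.S • z) = (z : ℂ) ^ 12 * ModularForm.discriminant z := by
  have h := slash_S_apply' ModularForm.discriminant 12 z
  rw [ModularForm.discriminant_S_invariant] at h
  have hz : (z : ℂ) ≠ 0 := z.ne_zero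
  rw [h, mul_comm, mul_assoc, ← zpow_natCast, show ((12 : ℕ) : ℤ) = 12 from rfl, ← zpow_add₀ hz, neg_add_cancel,
    zpow_zero, mul_one]

/-! ## The multiplied-out `S`-twisted kernel -/

/-- **Off the poles, `𝒦₊^{(8)}(τ,Sz)z²Δ(τ)Δ(z)(j(τ)−j(z)) = c[φ₋₂E₆(R + ΔE₈E₂²) − 2φ₀E₄(R + ΔE₁₀E₂) + φ₂E₁₄Δ(z)]`**,
and the norm inequality `‖L‖ ≤ ‖bracket‖` everywhere. [cite: CohnEtAl2019, Lemma 4.9 (proof)] -/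
def plus8SBracket (τ z : ℍ) : ℂ :=
  (π : ℂ) ^ 2 / (36 * I) *
    (phiNeg2 τ * E₆ τ * ((E₄ τ ^ 3 * ModularForm.discriminant z - E₄ z ^ 3 * ModularForm.discriminant τ) +
        ModularForm.discriminant τ * (E8fun z * E2 z ^ 2)) -
      2 * phi0 τ * E₄ τ * ((E₄ τ ^ 3 * ModularForm.discriminant z - E₄ z ^ 3 * ModularForm.discriminant τ) +
        ModularForm.discriminant τ * (E10fun z * E2 z)) +
      phi2 τ * E14fun τ * ModularForm.discriminant z)

/-- `kernelPlus8_S_mul_eq` (auxiliary). [cite: CohnEtAl2019, Lemma 4.9 (proof)] -/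
theorem kernelPlus8_S_mul_eq (τ z : ℍ) (hJ : kleinJ τ - kleinJ z ≠ 0) :
    kernelPlus8 τ (ModularGroup.S • z) * (z : ℂ) ^ 2 *
      (ModularForm.discriminant τ * ModularForm.discriminant z * (kleinJ τ - kleinJ z)) = plus8SBracket τ z := by
  have hz : (z : ℂ) ≠ 0 := z.ne_zero
  have hΔz := ModularForm.discriminant_ne_zero z
  have hΔτ := ModularForm.discriminant_ne_zero τ
  have hjz : kleinJ z * ModularForm.discriminant z = E₄ z ^ 3 := (E₄_cube_eq_kleinJ_mul z).symm
  have hjτ : kleinJ τ * ModularForm.discriminant τ = E₄ τ ^ 3 := (E₄_cube_eq_kleinJ_mul τ).symm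
  simp only [kernelPlus8, plus8SBracket, kleinJ_smul, discriminant_S_smul', phiTildeNeg2_S_smul, phiTilde0_S_smul,
    phiTilde2_S_smul, E8fun, E10fun, E14fun, f2fun, Pi.mul_apply, Pi.inv_apply, E₄_S_smul, E₆_S_smul]
  field_simp
  -- replace `kleinJ · Δ` by `E₄³`
  have e1 : kleinJ τ = E₄ τ ^ 3 / ModularForm.discriminant τ := by rw [eq_div_iff hΔτ]; exact hjτ
  have e2 : kleinJ z = E₄ z ^ 3 / ModularForm.discriminant z := by rw [eq_div_iff hΔz]; exact hjz
  rw [e1, e2]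
  field_simp
  ring

/-- `norm_kernelPlus8_S_mul_le` (auxiliary). [cite: CohnEtAl2019, Lemma 4.9 (proof)] -/
theorem norm_kernelPlus8_S_mul_le (τ z : ℍ) :
    ‖kernelPlus8 τ (ModularGroup.S • z) * (z : ℂ) ^ 2 *
      (ModularForm.discriminant τ * ModularForm.discriminant z * (kleinJ τ - kleinJ z))‖ ≤ ‖plus8SBracket τ z‖ := by
  by_cases hJ : kleinJ τ - kleinJ z = 0
  · rw [hJ]; simp
  · rw [kernelPlus8_S_mul_eq τ z hJ]

/-! ## Uniform bounds for the factors on `Im ≥ δ` -/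

/-- Level-one modular forms and `E₂` are bounded on half-planes `Im τ ≥ δ`. [folklore] -/
theorem exists_bound_levelOne {k : ℤ} (f : ModularForm 𝒮ℒ k) {δ : ℝ} (hδ : 0 < δ) :
    ∃ B : ℝ, ∀ τ : ℍ, δ ≤ τ.im → ‖f τ‖ ≤ B := by
  have hT : (⇑f : ℍ → ℂ) ∣[k] ModularGroup.T = ⇑f := f.slash_action_eq' _ ⟨ModularGroup.T, rfl⟩
  have hper : ∀ τ : ℍ, f ((1 : ℝ) +ᵥ τ) = f τ := fun τ => by
    have := slash_T_apply (⇑f) k τ; rw [hT] at this; exact this.symm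
  exact exists_bound_of_periodic f.holo'.continuous hper (ModularFormClass.bdd_at_infty f) hδ

/-- `exists_bound_E2` (auxiliary). [cite: CohnEtAl2019, Lemma 4.9 (proof)] -/
theorem exists_bound_E2 {δ : ℝ} (hδ : 0 < δ) : ∃ B : ℝ, ∀ τ : ℍ, δ ≤ τ.im → ‖E2 τ‖ ≤ B :=
  exists_bound_of_periodic E2_mdifferentiable.continuous E2_vadd_one EisensteinSeries.isBoundedAtImInfty_E2 hδ

/-- First-order uniform bounds on `Im z ≥ δ`: `|Δ(z)| ≤ Cq`, `|E₄(z) − 1| ≤ Cq`, `|E₆(z) − 1| ≤ Cq`,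
`|E₂(z) − 1| ≤ Cq` (`q = e^{−2π Im z}`). [cite: CohnEtAl2019, §2.1.1 (2.1), (2.3)] -/
theorem firstOrder_uniform {δ : ℝ} (hδ : 0 < δ) : ∃ C : ℝ, ∀ z : ℍ, δ ≤ z.im →
    ‖ModularForm.discriminant z‖ ≤ C * expDecay z ∧ ‖E₄ z - 1‖ ≤ C * expDecay z ∧
      ‖E₆ z - 1‖ ≤ C * expDecay z ∧ ‖E2 z - 1‖ ≤ C * expDecay z := by
  obtain ⟨⟨C₄, h₄⟩, ⟨C₆, h₆⟩, ⟨CΔ, hΔ⟩, ⟨C₂, h₂⟩⟩ := eisenstein_uniform hδ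
  refine ⟨(|C₄| + |C₆| + |CΔ| + |C₂|) + 20000, fun z hz => ?_⟩
  have hq : ‖qfun z‖ = expDecay z := norm_qfun z
  have hq1 : expDecay z ≤ 1 := expDecay_le_one z
  have hq0 : 0 < expDecay z := expDecay_pos z
  have hb6 : expDecayHalf z ^ 6 = expDecay z ^ 3 := by rw [expDecay_eq_sq]; ring
  have hb6le : expDecayHalf z ^ 6 ≤ expDecay z := by
    rw [hb6]; calc expDecay z ^ 3 ≤ expDecay z ^ 1 := pow_le_pow_of_le_one hq0.le hq1 (by norm_num)
      _ = expDecay z := pow_one _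
  have hq2 : expDecay z ^ 2 ≤ expDecay z := by nlinarith
  have key : ∀ {x : ℂ} {C : ℝ} (a b : ℝ), ‖x - a * qfun z - b * qfun z ^ 2‖ ≤ C * expDecayHalf z ^ 6 →
      ‖x‖ ≤ (|C| + (|a| + |b|)) * expDecay z := by
    intro x C a b h
    have h1 : ‖x‖ ≤ ‖x - a * qfun z - b * qfun z ^ 2‖ + |a| * expDecay z + |b| * expDecay z ^ 2 := by
      have := norm_add_le (x - a * qfun z - b * qfun z ^ 2) (a * qfun z + b * qfun z ^ 2)
      rw [show x - a * qfun z - b * qfun z ^ 2 + (a * qfun z + b * qfun z ^ 2) = x by ring] at this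
      refine this.trans ?_
      have hab := norm_add_le ((a : ℂ) * qfun z) (b * qfun z ^ 2)
      rw [norm_mul, norm_mul, norm_pow, Complex.norm_real, Complex.norm_real, hq, Real.norm_eq_abs, Real.norm_eq_abs] at hab
      linarith
    have h2 : ‖x - a * qfun z - b * qfun z ^ 2‖ ≤ |C| * expDecay z :=
      h.trans ((mul_le_mul_of_nonneg_right (le_abs_self C) (pow_nonneg (expDecayHalf_pos z).le 6)).trans
        (mul_le_mul_of_nonneg_left hb6le (abs_nonneg C)))
    nlinarith [mul_nonneg (abs_nonneg b) (sub_nonneg.2 hq2), abs_nonneg a]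
  have hsum0 : 0 ≤ |C₄| + |C₆| + |CΔ| + |C₂| := by positivity
  refine ⟨?_, ?_, ?_, ?_⟩
  · -- `Δ = (Δ − q + 24q²) + q − 24q²`: use `key` with `x = Δ`, `a = 1`, `b = −24`
    have h := key (x := ModularForm.discriminant z) 1 (-24) (by
      have := hΔ z hz
      rwa [show ModularForm.discriminant z - qfun z + 24 * qfun z ^ 2 =
        ModularForm.discriminant z - ((1 : ℝ) : ℂ) * qfun z - ((-24 : ℝ) : ℂ) * qfun z ^ 2 by push_cast; ring] at this)
    refine h.trans (mul_le_mul_of_nonneg_right ?_ hq0.le)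
    norm_num; linarith [abs_nonneg C₄, abs_nonneg C₆, abs_nonneg C₂]
  · have h := key (x := E₄ z - 1) 240 2160 (by
      have := h₄ z hz
      rwa [show E₄ z - 1 - 240 * qfun z - 2160 * qfun z ^ 2 =
        E₄ z - 1 - ((240 : ℝ) : ℂ) * qfun z - ((2160 : ℝ) : ℂ) * qfun z ^ 2 by push_cast; ring] at this)
    refine h.trans (mul_le_mul_of_nonneg_right ?_ hq0.le)
    norm_num; linarith [abs_nonneg C₆, abs_nonneg CΔ, abs_nonneg C₂]
  · have h := key (x := E₆ z - 1) (-504) (-16632) (by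
      have := h₆ z hz
      rwa [show E₆ z - 1 + 504 * qfun z + 16632 * qfun z ^ 2 =
        E₆ z - 1 - ((-504 : ℝ) : ℂ) * qfun z - ((-16632 : ℝ) : ℂ) * qfun z ^ 2 by push_cast; ring] at this)
    refine h.trans (mul_le_mul_of_nonneg_right ?_ hq0.le)
    norm_num; linarith [abs_nonneg C₄, abs_nonneg CΔ, abs_nonneg C₂]
  · have h := key (x := E2 z - 1) (-24) (-72) (by
      have := h₂ z hz
      rwa [show E2 z - 1 + 24 * qfun z + 72 * qfun z ^ 2 =
        E2 z - 1 - ((-24 : ℝ) : ℂ) * qfun z - ((-72 : ℝ) : ℂ) * qfun z ^ 2 by push_cast; ring] at this)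
    refine h.trans (mul_le_mul_of_nonneg_right ?_ hq0.le)
    norm_num; linarith [abs_nonneg C₄, abs_nonneg C₆, abs_nonneg CΔ]

/-! ## Uniform bounds as `IsBigO` along the principal filter of a half-plane -/

/-- The closed half-plane `{Im τ ≥ δ}`. [folklore] -/
def halfPlane (δ : ℝ) : Set ℍ := {τ | δ ≤ τ.im}

/-- `mem_halfPlane` (auxiliary). [cite: CohnEtAl2019, Lemma 4.9 (proof)] -/
theorem mem_halfPlane {δ : ℝ} {τ : ℍ} : τ ∈ halfPlane δ ↔ δ ≤ τ.im := Iff.rfl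

/-- Basic uniform `O`-facts on `Im τ ≥ δ`: `E₄ − 1, E₆ − 1, E₂ − 1, Δ = O(q)`; `E₄, E₆, E₂, E₁₄, q = O(1)`;
`1 = O(|τ|)`, `τ = O(|τ|)`; `φ₋₂, φ₀, φ₂ = O(|τ|)`. [cite: CohnEtAl2019, Lemma 4.9 (proof)] -/
theorem halfPlane_isBigO_basic {δ : ℝ} (hδ : 0 < δ) :
    ((fun τ : ℍ => E₄ τ - 1) =O[𝓟 (halfPlane δ)] expDecay) ∧ ((fun τ : ℍ => E₆ τ - 1) =O[𝓟 (halfPlane δ)] expDecay) ∧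
    ((fun τ : ℍ => E2 τ - 1) =O[𝓟 (halfPlane δ)] expDecay) ∧
    ((ModularForm.discriminant : ℍ → ℂ) =O[𝓟 (halfPlane δ)] expDecay) ∧
    ((⇑E₄ : ℍ → ℂ) =O[𝓟 (halfPlane δ)] (fun _ : ℍ => (1 : ℝ))) ∧ ((⇑E₆ : ℍ → ℂ) =O[𝓟 (halfPlane δ)] (fun _ : ℍ => (1 : ℝ))) ∧
    (E2 =O[𝓟 (halfPlane δ)] (fun _ : ℍ => (1 : ℝ))) ∧
    ((fun _ : ℍ => (1 : ℂ)) =O[𝓟 (halfPlane δ)] (fun τ : ℍ => ‖(τ : ℂ)‖)) ∧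
    ((fun τ : ℍ => (τ : ℂ)) =O[𝓟 (halfPlane δ)] (fun τ : ℍ => ‖(τ : ℂ)‖)) ∧
    (expDecay =O[𝓟 (halfPlane δ)] (fun _ : ℍ => (1 : ℝ))) := by
  obtain ⟨C₁, hC₁⟩ := firstOrder_uniform hδ
  obtain ⟨B₂, hB₂⟩ := exists_bound_E2 hδ
  obtain ⟨B₄, hB₄⟩ := exists_bound_levelOne E₄ hδ
  obtain ⟨B₆, hB₆⟩ := exists_bound_levelOne E₆ hδ
  have mk : ∀ {f : ℍ → ℂ} {g : ℍ → ℝ} (C : ℝ), (∀ τ : ℍ, δ ≤ τ.im → ‖f τ‖ ≤ C * g τ) → (∀ τ, 0 ≤ g τ) →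
      f =O[𝓟 (halfPlane δ)] g := by
    intro f g C h hg
    rw [isBigO_principal]
    exact ⟨C, fun τ hτ => by rw [Real.norm_of_nonneg (hg τ)]; exact h τ hτ⟩
  refine ⟨mk C₁ (fun τ h => (hC₁ τ h).2.1) fun τ => (expDecay_pos τ).le,
    mk C₁ (fun τ h => (hC₁ τ h).2.2.1) fun τ => (expDecay_pos τ).le,
    mk C₁ (fun τ h => (hC₁ τ h).2.2.2) fun τ => (expDecay_pos τ).le,
    mk C₁ (fun τ h => (hC₁ τ h).1) fun τ => (expDecay_pos τ).le,
    mk B₄ (fun τ h => by simpa using hB₄ τ h) fun _ => zero_le_one,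
    mk B₆ (fun τ h => by simpa using hB₆ τ h) fun _ => zero_le_one,
    mk B₂ (fun τ h => by simpa using hB₂ τ h) fun _ => zero_le_one, ?_, ?_, ?_⟩
  · refine mk (1 / δ) (fun τ hτ => ?_) fun τ => norm_nonneg _
    have hτ1 : δ ≤ ‖(τ : ℂ)‖ := hτ.trans (im_le_norm_coe τ)
    rw [norm_one, one_div, inv_mul_eq_div, le_div_iff₀ hδ, one_mul]; exact hτ1
  · exact mk 1 (fun τ _ => by simp) fun τ => norm_nonneg _
  · rw [isBigO_principal]
    exact ⟨1, fun τ _ => by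
      rw [Real.norm_of_nonneg (expDecay_pos τ).le, norm_one, mul_one]; exact expDecay_le_one τ⟩

/-- `φ₋₂, φ₀, φ₂ = O(|τ|)` uniformly on `Im τ ≥ δ`. [cite: CohnEtAl2019, §4.2] -/
theorem halfPlane_isBigO_phi {δ : ℝ} (hδ : 0 < δ) :
    (phiNeg2 =O[𝓟 (halfPlane δ)] fun τ : ℍ => ‖(τ : ℂ)‖) ∧ (phi0 =O[𝓟 (halfPlane δ)] fun τ : ℍ => ‖(τ : ℂ)‖) ∧
    (phi2 =O[𝓟 (halfPlane δ)] fun τ : ℍ => ‖(τ : ℂ)‖) := by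
  obtain ⟨_, _, _, _, _, _, hE2, h1, hcoe, _⟩ := halfPlane_isBigO_basic hδ
  refine ⟨hcoe.congr_left fun τ => rfl, ?_, ?_⟩
  · have t1 : (fun τ : ℍ => (τ : ℂ) * E2 τ) =O[𝓟 (halfPlane δ)] fun τ : ℍ => ‖(τ : ℂ)‖ := by
      simpa using hcoe.mul hE2
    have t2 : (fun _ : ℍ => (3 * I / π : ℂ)) =O[𝓟 (halfPlane δ)] fun τ : ℍ => ‖(τ : ℂ)‖ := by
      simpa using h1.const_mul_left (3 * I / π : ℂ)
    exact (t1.sub t2).congr_left fun τ => by simp [phi0]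
  · have t1 : (fun τ : ℍ => (τ : ℂ) * E2 τ ^ 2) =O[𝓟 (halfPlane δ)] fun τ : ℍ => ‖(τ : ℂ)‖ := by
      simpa [sq] using hcoe.mul (hE2.mul hE2)
    have t2 : (fun τ : ℍ => (6 * I / π : ℂ) * E2 τ) =O[𝓟 (halfPlane δ)] fun τ : ℍ => ‖(τ : ℂ)‖ := by
      simpa using (h1.mul hE2).const_mul_left (6 * I / π : ℂ)
    exact (t1.sub t2).congr_left fun τ => by simp [phi2]

/-- Algebraic decomposition of the bracket exhibiting the cancellations of the constant terms in
`q_τ` and in `q_z`. [cite: CohnEtAl2019, Lemma 4.9 (proof)] -/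
theorem plus8SBracket_decomp (τ z : ℍ) : plus8SBracket τ z = (π : ℂ) ^ 2 / (36 * I) *
    ( (τ : ℂ) * (E₆ τ * E₄ τ ^ 3 - 1) * ModularForm.discriminant z
      - 2 * ((τ : ℂ) * ((E2 τ - 1) * E₄ τ ^ 4) * ModularForm.discriminant z +
          ((τ : ℂ) - 3 * I / π) * (E₄ τ ^ 4 - 1) * ModularForm.discriminant z)
      + ((τ : ℂ) * ((E2 τ - 1) * (E2 τ + 1) * E14fun τ) * ModularForm.discriminant z
          - 6 * I / π * 1 * ((E2 τ - 1) * E14fun τ) * ModularForm.discriminant z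
          + ((τ : ℂ) - 6 * I / π) * (E14fun τ - 1) * ModularForm.discriminant z)
      - phiNeg2 τ * E₆ τ * ModularForm.discriminant τ * (E₄ z ^ 3 - 1)
      + phiNeg2 τ * E₆ τ * ModularForm.discriminant τ * (E8fun z * E2 z ^ 2 - 1)
      + 2 * (phi0 τ * E₄ τ * ModularForm.discriminant τ * (E₄ z ^ 3 - 1))
      - 2 * (phi0 τ * E₄ τ * ModularForm.discriminant τ * (E10fun z * E2 z - 1)) ) := by
  simp only [plus8SBracket, phiNeg2, phi0, phi2, E14fun, E10fun, E8fun, Pi.mul_apply]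
  ring

/-! ## Derived uniform `O`-facts -/

/-- Products on the half-plane: the `τ`-side and `z`-side factor estimates. [cite: CohnEtAl2019, Lemma 4.9 (proof)] -/
theorem halfPlane_isBigO_factors {δ : ℝ} (hδ : 0 < δ) :
    ((fun τ : ℍ => E₆ τ * E₄ τ ^ 3 - 1) =O[𝓟 (halfPlane δ)] expDecay) ∧
    ((fun τ : ℍ => E₄ τ ^ 4 - 1) =O[𝓟 (halfPlane δ)] expDecay) ∧
    ((fun τ : ℍ => E₄ τ ^ 4) =O[𝓟 (halfPlane δ)] fun _ : ℍ => (1 : ℝ)) ∧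
    ((fun τ : ℍ => E14fun τ - 1) =O[𝓟 (halfPlane δ)] expDecay) ∧
    (E14fun =O[𝓟 (halfPlane δ)] fun _ : ℍ => (1 : ℝ)) ∧
    ((fun τ : ℍ => (E2 τ - 1) * (E2 τ + 1)) =O[𝓟 (halfPlane δ)] expDecay) ∧
    ((fun τ : ℍ => (τ : ℂ) - 3 * I / π) =O[𝓟 (halfPlane δ)] fun τ : ℍ => ‖(τ : ℂ)‖) ∧
    ((fun τ : ℍ => (τ : ℂ) - 6 * I / π) =O[𝓟 (halfPlane δ)] fun τ : ℍ => ‖(τ : ℂ)‖) ∧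
    ((fun z : ℍ => E₄ z ^ 3 - 1) =O[𝓟 (halfPlane δ)] expDecay) ∧
    ((fun z : ℍ => E8fun z * E2 z ^ 2 - 1) =O[𝓟 (halfPlane δ)] expDecay) ∧
    ((fun z : ℍ => E10fun z * E2 z - 1) =O[𝓟 (halfPlane δ)] expDecay) := by
  obtain ⟨h4, h6, h2, hΔ, hE4, hE6, hE2, h1, hcoe, hq1⟩ := halfPlane_isBigO_basic hδ
  have one1 : (fun _ : ℍ => (1 : ℂ)) =O[𝓟 (halfPlane δ)] fun _ : ℍ => (1 : ℝ) := isBigO_const_const _ one_ne_zero _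
  -- bounded × small
  have bs : ∀ {u v : ℍ → ℂ}, u =O[𝓟 (halfPlane δ)] (fun _ : ℍ => (1 : ℝ)) → v =O[𝓟 (halfPlane δ)] expDecay →
      (fun τ => u τ * v τ) =O[𝓟 (halfPlane δ)] expDecay := fun hu hv => by simpa using hu.mul hv
  have bb : ∀ {u v : ℍ → ℂ}, u =O[𝓟 (halfPlane δ)] (fun _ : ℍ => (1 : ℝ)) → v =O[𝓟 (halfPlane δ)] (fun _ : ℍ => (1 : ℝ)) →
      (fun τ => u τ * v τ) =O[𝓟 (halfPlane δ)] fun _ : ℍ => (1 : ℝ) := fun hu hv => by simpa using hu.mul hv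
  have hE4_2 : (fun τ : ℍ => E₄ τ ^ 2) =O[𝓟 (halfPlane δ)] fun _ : ℍ => (1 : ℝ) := by simpa [sq] using bb hE4 hE4
  have hE4_3 : (fun τ : ℍ => E₄ τ ^ 3) =O[𝓟 (halfPlane δ)] fun _ : ℍ => (1 : ℝ) := by
    simpa [pow_succ] using bb hE4_2 hE4
  have hE4_4 : (fun τ : ℍ => E₄ τ ^ 4) =O[𝓟 (halfPlane δ)] fun _ : ℍ => (1 : ℝ) := by
    simpa [pow_succ] using bb hE4_3 hE4
  have h43 : (fun z : ℍ => E₄ z ^ 3 - 1) =O[𝓟 (halfPlane δ)] expDecay := by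
    have := bs ((hE4_2.add hE4).add one1) h4
    exact this.congr_left fun τ => by ring
  have h44 : (fun τ : ℍ => E₄ τ ^ 4 - 1) =O[𝓟 (halfPlane δ)] expDecay := by
    have := (bs hE4 h43).add h4
    exact this.congr_left fun τ => by ring
  have h14 : (fun τ : ℍ => E14fun τ - 1) =O[𝓟 (halfPlane δ)] expDecay := by
    have := (bs hE4_2 h6).add (bs (hE4.add one1) h4)
    exact this.congr_left fun τ => by simp only [E14fun, Pi.mul_apply]; ring
  have hE14 : E14fun =O[𝓟 (halfPlane δ)] fun _ : ℍ => (1 : ℝ) :=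
    (bb (bb hE4 hE4) hE6).congr_left fun τ => by simp only [E14fun, Pi.mul_apply]
  have h22 : (fun τ : ℍ => (E2 τ - 1) * (E2 τ + 1)) =O[𝓟 (halfPlane δ)] expDecay := by
    have := bs (hE2.add one1) h2
    exact this.congr_left fun τ => by ring
  have h42 : (fun z : ℍ => E₄ z * E2 z - 1) =O[𝓟 (halfPlane δ)] expDecay := by
    have := (bs hE2 h4).add h2
    exact this.congr_left fun τ => by ring
  refine ⟨?_, h44, hE4_4, h14, hE14, h22, ?_, ?_, h43, ?_, ?_⟩
  · have := (bs hE4_3 h6).add h43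
    exact this.congr_left fun τ => by ring
  · simpa using hcoe.sub (h1.const_mul_left (3 * I / π : ℂ))
  · simpa using hcoe.sub (h1.const_mul_left (6 * I / π : ℂ))
  · have := bs ((bb hE4 hE2).add one1) h42
    exact this.congr_left fun τ => by simp only [E8fun, Pi.mul_apply]; ring
  · have := (bs hE6 h42).add h6
    exact this.congr_left fun τ => by simp only [E10fun, Pi.mul_apply]; ring

/-! ## Two variables: the product principal filter -/

/-- Lifting one-variable uniform bounds to `ℍ × ℍ` along the projections. [folklore] -/
theorem isBigO_fst_of_halfPlane {δ : ℝ} {f : ℍ → ℂ} {g : ℍ → ℝ} (h : f =O[𝓟 (halfPlane δ)] g) :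
    (fun p : ℍ × ℍ => f p.1) =O[𝓟 (halfPlane δ ×ˢ halfPlane δ)] fun p => g p.1 :=
  h.comp_tendsto (tendsto_principal_principal.2 fun _ hp => hp.1)

/-- `isBigO_snd_of_halfPlane` (auxiliary). [cite: CohnEtAl2019, Lemma 4.9 (proof)] -/
theorem isBigO_snd_of_halfPlane {δ : ℝ} {f : ℍ → ℂ} {g : ℍ → ℝ} (h : f =O[𝓟 (halfPlane δ)] g) :
    (fun p : ℍ × ℍ => f p.2) =O[𝓟 (halfPlane δ ×ˢ halfPlane δ)] fun p => g p.2 :=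
  h.comp_tendsto (tendsto_principal_principal.2 fun _ hp => hp.2)

/-- **The master bound as an `O`-statement on `{Im τ ≥ δ} × {Im z ≥ δ}`**:
`bracket(τ,z) = O(|τ| e^{−2π Im τ} e^{−2π Im z})`. [cite: CohnEtAl2019, Lemma 4.9 (proof)] -/
theorem plus8SBracket_isBigO {δ : ℝ} (hδ : 0 < δ) :
    (fun p : ℍ × ℍ => plus8SBracket p.1 p.2) =O[𝓟 (halfPlane δ ×ˢ halfPlane δ)]
      fun p => ‖(p.1 : ℂ)‖ * expDecay p.1 * expDecay p.2 := by
  obtain ⟨h4, h6, h2, hΔ, hE4, hE6, hE2, h1, hcoe, hq1⟩ := halfPlane_isBigO_basic hδ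
  obtain ⟨hφm, hφ0, hφ2⟩ := halfPlane_isBigO_phi hδ
  obtain ⟨f1, f2, f3, f4, f5, f6, f7, f8, z1, z2, z3⟩ := halfPlane_isBigO_factors hδ
  -- lift everything
  set F := 𝓟 (halfPlane δ ×ˢ halfPlane δ) with hF
  -- generic assembly: `(a·b)(τ) · c(z)` with `a = O(|τ|)`, `b = O(q_τ)` (or `a = O(|τ| q_τ)`), `c = O(q_z)`
  have T : ∀ {a b : ℍ → ℂ} {c : ℍ → ℂ}, a =O[𝓟 (halfPlane δ)] (fun τ : ℍ => ‖(τ : ℂ)‖) →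
      b =O[𝓟 (halfPlane δ)] expDecay → c =O[𝓟 (halfPlane δ)] expDecay →
      (fun p : ℍ × ℍ => a p.1 * b p.1 * c p.2) =O[F] fun p => ‖(p.1 : ℂ)‖ * expDecay p.1 * expDecay p.2 := by
    intro a b c ha hb hc
    exact ((isBigO_fst_of_halfPlane ha).mul (isBigO_fst_of_halfPlane hb)).mul (isBigO_snd_of_halfPlane hc)
  -- bounded τ-factors can be absorbed into `a`
  have A1 : ∀ {a u : ℍ → ℂ}, a =O[𝓟 (halfPlane δ)] (fun τ : ℍ => ‖(τ : ℂ)‖) → u =O[𝓟 (halfPlane δ)] (fun _ : ℍ => (1 : ℝ)) →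
      (fun τ => a τ * u τ) =O[𝓟 (halfPlane δ)] (fun τ : ℍ => ‖(τ : ℂ)‖) := fun ha hu => by simpa using ha.mul hu
  have B1 : ∀ {b u : ℍ → ℂ}, b =O[𝓟 (halfPlane δ)] expDecay → u =O[𝓟 (halfPlane δ)] (fun _ : ℍ => (1 : ℝ)) →
      (fun τ => b τ * u τ) =O[𝓟 (halfPlane δ)] expDecay := fun hb hu => by simpa using hb.mul hu
  -- the seven terms of `plus8SBracket_decomp`
  have s1 := T hcoe f1 hΔ
  have s2a := T hcoe (B1 h2 f3) hΔ          -- `τ (E₂−1) E₄⁴ · Δ(z)`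
  have s2b := T f7 f2 hΔ                    -- `(τ − 3i/π)(E₄⁴ − 1) · Δ(z)`
  have s3a := T hcoe (B1 f6 f5) hΔ          -- `τ (E₂−1)(E₂+1) E₁₄ · Δ(z)`
  have s3b := T (h1.const_mul_left (6 * I / π : ℂ)) (B1 h2 f5) hΔ   -- `(6i/π)(E₂−1)E₁₄ · Δ(z)`
  have s3c := T f8 f4 hΔ                    -- `(τ − 6i/π)(E₁₄ − 1) · Δ(z)`
  have s4 := T (A1 hφm hE6) hΔ z1           -- `φ₋₂E₆ · Δ(τ) · (E₄(z)³ − 1)`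
  have s5 := T (A1 hφm hE6) hΔ z2
  have s6 := T (A1 hφ0 hE4) hΔ z1
  have s7 := T (A1 hφ0 hE4) hΔ z3
  have total := ((((((s1.sub ((s2a.add s2b).const_mul_left 2)).add ((s3a.sub s3b).add s3c)).sub s4).add s5).add
    (s6.const_mul_left 2)).sub (s7.const_mul_left 2)).const_mul_left ((π : ℂ) ^ 2 / (36 * I))
  refine total.congr_left fun p => ?_
  rw [plus8SBracket_decomp]

/-- **The master bound**: on `Im τ, Im z ≥ δ`,
`‖𝒦₊^{(8)}(τ,Sz)z²Δ(τ)Δ(z)(j(τ)−j(z))‖ ≤ C|τ| e^{−2π Im τ} e^{−2π Im z}`.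
[cite: CohnEtAl2019, Lemma 4.9 (4.15), (4.17)] -/
theorem kernelPlus8_S_master_bound {δ : ℝ} (hδ : 0 < δ) : ∃ C : ℝ, ∀ τ z : ℍ, δ ≤ τ.im → δ ≤ z.im →
    ‖kernelPlus8 τ (ModularGroup.S • z) * (z : ℂ) ^ 2 *
      (ModularForm.discriminant τ * ModularForm.discriminant z * (kleinJ τ - kleinJ z))‖
        ≤ C * (‖(τ : ℂ)‖ * expDecay τ * expDecay z) := by
  obtain ⟨C, hC⟩ := isBigO_principal.1 (plus8SBracket_isBigO hδ)
  refine ⟨C, fun τ z hτ hz => (norm_kernelPlus8_S_mul_le τ z).trans ?_⟩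
  have := hC (τ, z) ⟨hτ, hz⟩
  rwa [Real.norm_of_nonneg (mul_nonneg (mul_nonneg (norm_nonneg _) (expDecay_pos _).le) (expDecay_pos _).le)] at this

/-- **Lemma 4.9 (4.15) for `𝒦₊^{(8)}`, `γ = I`** (multiplied-out form): on `Im τ, Im z ≥ δ`,
`‖𝒦₊^{(8)}(τ,Sz)z²·Δ(τ)Δ(z)(j(τ)−j(z))‖ ≤ C|τ|²|z|²e^{−2π Im z}` (`= C|e^{πi·2z}τ²z²|`).
[cite: CohnEtAl2019, Lemma 4.9 (4.15)] -/
theorem kernelPlus8_S_bound_415 {δ : ℝ} (hδ : 0 < δ) : ∃ C : ℝ, ∀ τ z : ℍ, δ ≤ τ.im → δ ≤ z.im →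
    ‖kernelPlus8 τ (ModularGroup.S • z) * (z : ℂ) ^ 2 *
      (ModularForm.discriminant τ * ModularForm.discriminant z * (kleinJ τ - kleinJ z))‖
        ≤ C * (‖(τ : ℂ)‖ ^ 2 * ‖(z : ℂ)‖ ^ 2 * expDecay z) := by
  obtain ⟨C, hC⟩ := kernelPlus8_S_master_bound hδ
  refine ⟨|C| / δ ^ 3, fun τ z hτ hz => (hC τ z hτ hz).trans ?_⟩
  have hτ1 : δ ≤ ‖(τ : ℂ)‖ := hτ.trans (im_le_norm_coe τ)
  have hz1 : δ ≤ ‖(z : ℂ)‖ := hz.trans (im_le_norm_coe z)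
  have hq := expDecay_pos z
  have hqτ := expDecay_le_one τ
  have hqτ0 := expDecay_pos τ
  have hX0 : 0 ≤ ‖(τ : ℂ)‖ * expDecay τ * expDecay z := mul_nonneg (mul_nonneg (norm_nonneg _) hqτ0.le) hq.le
  have h1 : C * (‖(τ : ℂ)‖ * expDecay τ * expDecay z) ≤ |C| * (‖(τ : ℂ)‖ * expDecay z) := by
    have : C * (‖(τ : ℂ)‖ * expDecay τ * expDecay z) ≤ |C| * (‖(τ : ℂ)‖ * expDecay τ * expDecay z) :=
      mul_le_mul_of_nonneg_right (le_abs_self C) hX0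
    refine this.trans (mul_le_mul_of_nonneg_left ?_ (abs_nonneg C))
    rw [show ‖(τ : ℂ)‖ * expDecay τ * expDecay z = ‖(τ : ℂ)‖ * expDecay z * expDecay τ by ring]
    exact mul_le_of_le_one_right (mul_nonneg (norm_nonneg _) hq.le) hqτ
  have h2 : |C| * (‖(τ : ℂ)‖ * expDecay z) ≤ |C| / δ ^ 3 * (‖(τ : ℂ)‖ ^ 2 * ‖(z : ℂ)‖ ^ 2 * expDecay z) := by
    rw [show |C| / δ ^ 3 * (‖(τ : ℂ)‖ ^ 2 * ‖(z : ℂ)‖ ^ 2 * expDecay z) =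
      |C| * (‖(τ : ℂ)‖ * expDecay z) * ((‖(τ : ℂ)‖ / δ) * (‖(z : ℂ)‖ / δ) ^ 2) by field_simp]
    refine le_mul_of_one_le_right (mul_nonneg (abs_nonneg C) (mul_nonneg (norm_nonneg _) hq.le)) ?_
    have a : 1 ≤ ‖(τ : ℂ)‖ / δ := by rw [le_div_iff₀ hδ]; linarith
    have b : 1 ≤ ‖(z : ℂ)‖ / δ := by rw [le_div_iff₀ hδ]; linarith
    nlinarith [one_le_pow₀ (n := 2) b]
  exact h1.trans h2

/-- **Lemma 4.9 (4.17) for `𝒦₊^{(8)}`** (multiplied-out form): on `Im τ, Im z ≥ δ`,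
`‖𝒦₊^{(8)}(τ,Sz)z²·Δ(τ)Δ(z)(j(τ)−j(z))‖ ≤ C|τ|²|z|²e^{−2π Im τ}e^{−π Im z}` (`= C|e^{πi(2τ+z)}τ²z²|`).
[cite: CohnEtAl2019, Lemma 4.9 (4.17)] -/
theorem kernelPlus8_S_bound_417 {δ : ℝ} (hδ : 0 < δ) : ∃ C : ℝ, ∀ τ z : ℍ, δ ≤ τ.im → δ ≤ z.im →
    ‖kernelPlus8 τ (ModularGroup.S • z) * (z : ℂ) ^ 2 *
      (ModularForm.discriminant τ * ModularForm.discriminant z * (kleinJ τ - kleinJ z))‖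
        ≤ C * (‖(τ : ℂ)‖ ^ 2 * ‖(z : ℂ)‖ ^ 2 * expDecay τ * expDecayHalf z) := by
  obtain ⟨C, hC⟩ := kernelPlus8_S_master_bound hδ
  refine ⟨|C| / δ ^ 3, fun τ z hτ hz => (hC τ z hτ hz).trans ?_⟩
  have hτ1 : δ ≤ ‖(τ : ℂ)‖ := hτ.trans (im_le_norm_coe τ)
  have hz1 : δ ≤ ‖(z : ℂ)‖ := hz.trans (im_le_norm_coe z)
  have hq := expDecay_pos z
  have hqh := expDecayHalf_pos z
  have hqτ0 := expDecay_pos τ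
  have hqb : expDecay z ≤ expDecayHalf z := by
    rw [expDecay_eq_sq, sq]; exact mul_le_of_le_one_left hqh.le (expDecayHalf_le_one z)
  have h1 : C * (‖(τ : ℂ)‖ * expDecay τ * expDecay z) ≤ |C| * (‖(τ : ℂ)‖ * expDecay τ * expDecayHalf z) := by
    have hX0 : 0 ≤ ‖(τ : ℂ)‖ * expDecay τ * expDecay z := mul_nonneg (mul_nonneg (norm_nonneg _) hqτ0.le) hq.le
    have : C * (‖(τ : ℂ)‖ * expDecay τ * expDecay z) ≤ |C| * (‖(τ : ℂ)‖ * expDecay τ * expDecay z) :=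
      mul_le_mul_of_nonneg_right (le_abs_self C) hX0
    exact this.trans (mul_le_mul_of_nonneg_left (mul_le_mul_of_nonneg_left hqb
      (mul_nonneg (norm_nonneg _) hqτ0.le)) (abs_nonneg C))
  have h2 : |C| * (‖(τ : ℂ)‖ * expDecay τ * expDecayHalf z) ≤
      |C| / δ ^ 3 * (‖(τ : ℂ)‖ ^ 2 * ‖(z : ℂ)‖ ^ 2 * expDecay τ * expDecayHalf z) := by
    rw [show |C| / δ ^ 3 * (‖(τ : ℂ)‖ ^ 2 * ‖(z : ℂ)‖ ^ 2 * expDecay τ * expDecayHalf z) =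
      |C| * (‖(τ : ℂ)‖ * expDecay τ * expDecayHalf z) * ((‖(τ : ℂ)‖ / δ) * (‖(z : ℂ)‖ / δ) ^ 2) by field_simp]
    refine le_mul_of_one_le_right (mul_nonneg (abs_nonneg C) (mul_nonneg (mul_nonneg (norm_nonneg _) hqτ0.le) hqh.le)) ?_
    have a : 1 ≤ ‖(τ : ℂ)‖ / δ := by rw [le_div_iff₀ hδ]; linarith
    have b : 1 ≤ ‖(z : ℂ)‖ / δ := by rw [le_div_iff₀ hδ]; linarith
    nlinarith [one_le_pow₀ (n := 2) b]
  exact h1.trans h2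

end Literature.NumberTheory.ModularForms
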